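import Summits.SmoothPoincare4.SmoothPoincare4.Theses.SteinHost
import Summits.SmoothPoincare4.SmoothPoincare4.Theses.NoOneHandles
import Literature.Topology.FourManifolds.Handles
import Literature.Topology.FourManifolds.ClosedBall
import Literature.Topology.FourManifolds.CorkDecomposition
import Literature.Topology.FourManifolds.HomotopyS4CompactProofs
import Literature.Topology.FourManifolds.HomotopyS4OrientableProofs
import Literature.Geometry.Symplectic.SteinDomain
import Literature.Geometry.Symplectic.SteinHandlebodies
import Mathlib.Topology.Homotopy.Contractible

/-!
# Alternative line `stein-gsc` — crux `SteinSchoenflies` (item `stmt-SmoothPoincare4-18228`)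

Strategist line (registered ALONGSIDE the live skeleton `Lines/birth.lean`, never replacing it), route
`route-SmoothPoincare4-SteinHost`, rank-2 crux
`Summit.SmoothPoincare4.SmoothPoincare4.Theses.SteinHost.SteinSchoenflies`.

THE LINE — "a Stein-hosted fake ball is a 2-handlebody, so the homotopy sphere is geometrically simply
connected, and weak Generalised Property R standardises it":

  `SteinSchoenflies ⇐ BallInHost → ComplementContractible → SteinFakeBallTwoHandlebody → CapOffNoIndexOne
     → GscStandard`.

Where `birth` spends the Stein hypothesis on HULLS (Lambert-Cole's Conj. 1.10 verbatim: the embedded homotopy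
ball is a standard ball, then Cerf's `Γ₄ = 0`), this line spends it on MORSE INDICES: a strictly `J`-convex
function has interior critical points of index `≤ 2` only (tree, PROVED:
`Literature.Geometry.Symplectic.SteinStructure.morseIndex_le_two`,
`Literature.Geometry.Symplectic.IsSteinDomain.isHandlebodyOfIndexLE_two`), and in the relative Morse theory of
the compact piece `B ⊂ Int X` the only further handles come from boundary critical points of `φ|∂B` at which
`∇φ` points INTO `B` (Kronheimer–Mrowka, *Monopoles and three-manifolds* Def. 2.4.1; Borodzik–Némethi–Ranicki,
arXiv:1207.3066, Lemmas 19–20 and Thm. 27: boundary-unstable ⇒ a genuine handle of the boundary index,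
boundary-stable ⇒ no change of diffeomorphism type). So the 3-handles of `B` are exactly the INWARD LOCAL MAXIMA
of `φ|∂B` ("pockets"); the bet of the line (`stub_steinFakeBallTwoHandlebody`) is that a contractible `B` with
`∂B ≅ S³` inside a Stein domain needs none: it is a handlebody of index `≤ 2`
(`Literature.Topology.FourManifolds.IsHandlebodyOfIndexLE 3 2 B`). Capping off (`stub_capOffNoIndexOne`, a
theorem: `M = B ∪_φ 𝔻⁴ = B ∪ 4-handle`, read upside down, has a Morse function without index-1 critical points)
makes `M` geometrically simply connected, and the recognition of such homotopy spheres is EXACTLY the open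
rank-2 item `NoohGscStandard` of route `NoOneHandles` (stmt-SmoothPoincare4-0377 = the weak Generalised Property R
conjecture, Gompf–Scharlemann–Thompson arXiv:1103.1601 Conj. 4 p. 19 and p. 20: "equivalent to SPC4 for homotopy
spheres without 1-handles"), cited BY NAME so that one proof serves both routes. No Cerf, no twisted spheres, no
polynomial convexity.

Stubs (5, registered): `stub_ballInHost`, `stub_complementContractible` (VERBATIM the signatures of the same-named
stubs of `Lines/birth.lean` — shared work, proved once), `stub_steinFakeBallTwoHandlebody` (THE BET, the hardest
stub), `stub_capOffNoIndexOne` (Morse bookkeeping theorem, size L formally), `stub_gscStandard` (:= the route item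
`Summit.SmoothPoincare4.SmoothPoincare4.Theses.NoOneHandles.NoohGscStandard` by name; open, shared).
`SteinSchoenflies_of : stub₁ → … → stub₅ → SteinSchoenflies` is the REAL composition (sorry-free); `sorry`
occurs ONLY in the five `stub_*` theorems.

Disproof used (`Cruxes/SteinSchoenflies/Disproof.lean`, cdisprove 2026-08-17): no `_false_without_` theorem and
no landed `Negative/*` lemma exist; the Disproof notes that dropping `IsSteinDomain X` makes the crux ≡ SPC4
(`X := M ∖ ball`) — honoured: the Stein hypothesis is load-bearing in `stub_steinFakeBallTwoHandlebody` and ONLY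
there (for a non-Stein host the bet is false as typed iff a fake ball exists: take `X` = the fake ball itself
with an external collar); `M ≃ₕ S⁴` enters only `stub_complementContractible` and the `HomotopySphere 4`
packaging. Negatives index (`ledger negatives --problem SmoothPoincare4`): 0 refuted statements.
Barriers: OpenAnalogueBarrierFour respected (only the COMPACT piece `B` and the closed `M` are recognised, never
`M ∖ {p}` or `Int B`); StableBarrierFour / HCobordismBarrierFour not invoked (no stabilisation, no h-cobordism);
TwistedSphereBarrierFour not engaged (no `Γ₄`); RelativeContractibleBarrierFour not engaged (`∂B = S³`).
Credit: the Morse-index mechanism behind the bet is the crux idea `inward-maxima-are-three-handles`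
(`Cruxes/SteinSchoenflies/Ideas/`, cruxidea k2, 2026-08-17); this skeleton is mechanism-agnostic and types the
bet at handlebody level so that ANY pocket-elimination argument (drainage by re-choosing the `J`-convex function,
bilevel sweep-outs, or an isotopy of `B`) closes the same registered stub.
-/

set_option linter.dupNamespace false

noncomputable section

open scoped Manifold ContDiff Topology
open Set Function

namespace Summit.SmoothPoincare4.SmoothPoincare4.Cruxes.SteinSchoenflies.SteinGsc

open Summit.SmoothPoincare4.SmoothPoincare4.Theses.SteinHost (SteinSchoenflies)
open Summit.SmoothPoincare4.SmoothPoincare4.Theses.NoOneHandles (NoohGscStandard)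
open Literature.Topology.FourManifolds Literature.Geometry.Symplectic

/-! ## The five registered stubs -/

/-- **Stub 1 — the compact fake ball sits in the host (chart-ball excision; Palais).** VERBATIM the signature
of `Birth.stub_ballInHost` (shared with the live line): for every compact smooth 4-manifold `M`, `p ∈ M`, smooth
4-manifold with boundary `X` and smooth embedding `f : M ∖ {p} ↪ X` there are a compact smooth 4-manifold with
boundary `B`, a boundary datum `b` with `φ : ∂B ≅ S³`, a smooth embedding `e : B ↪ Int X` and a presentation
`M = B ∪_φ 𝔻⁴`. Why plausibly true: a theorem (Palais 1960 / Hirsch 1976 §8.2). Size: L (formal).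
[cite: HirschDT1976, §8.2] [cite: KervaireMilnorAnnals1963, proof of Lemma 2.3] -/
theorem stub_ballInHost :
    ∀ (M : Type) [TopologicalSpace M] [T2Space M] [SecondCountableTopology M]
      [ChartedSpace (EuclideanSpace ℝ (Fin 4)) M] [IsManifold (𝓡 4) ∞ M] [CompactSpace M] (p : M)
      (X : Type) [TopologicalSpace X] [T2Space X] [SecondCountableTopology X]
      [ChartedSpace (EuclideanHalfSpace 4) X] [IsManifold (𝓡∂ 4) ∞ X]
      (f : (⟨{p}ᶜ, isOpen_compl_singleton⟩ : TopologicalSpace.Opens M) → X),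
      Manifold.IsSmoothEmbedding (𝓡 4) (𝓡∂ 4) ∞ f →
      ∃ (B : Type) (_ : TopologicalSpace B) (_ : T2Space B) (_ : SecondCountableTopology B)
        (_ : ChartedSpace (EuclideanHalfSpace 4) B) (_ : IsManifold (𝓡∂ 4) ∞ B) (_ : CompactSpace B)
        (b : Literature.Topology.FourManifolds.BoundaryData (𝓡∂ 4) B (𝓡 3))
        (φ : b.carrier ≃ₘ⟮𝓡 3, 𝓡 3⟯ (Metric.sphere (0 : EuclideanSpace ℝ (Fin 4)) 1))
        (e : B → X),
        Manifold.IsSmoothEmbedding (𝓡∂ 4) (𝓡∂ 4) ∞ e ∧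
          Set.range e ⊆ (𝓡∂ 4).interior X ∧
          Literature.Topology.FourManifolds.IsBoundaryGluing b
            (Literature.Topology.FourManifolds.closedBallBoundaryData 3) φ (𝓡 4) M := by
  sorry

/-- **Stub 2 — the ball complement of a homotopy 4-sphere is contractible.** VERBATIM the signature of
`Birth.stub_complementContractible` (shared): if `M ≃ₕ S⁴` is a boundary gluing `B ∪_φ 𝔻⁴` with `B` compact,
`∂B ≅ S³`, then `B` is contractible (`B` is a deformation retract of `M ∖ {pt}`, contractible by the PROVED tree
fact `contractibleSpace_compl_singleton_of_homotopyEquiv_sphere_four`). Why plausibly true: a theorem. Size: M.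
[cite: FreedmanJDG1982, proof of Thm. 1.6 p. 371] [cite: HatcherAT2002, Prop. 3.29] -/
theorem stub_complementContractible :
    ∀ (M : Type) [TopologicalSpace M] [T2Space M] [SecondCountableTopology M]
      [ChartedSpace (EuclideanSpace ℝ (Fin 4)) M] [IsManifold (𝓡 4) ∞ M],
      ContinuousMap.HomotopyEquiv M (Metric.sphere (0 : EuclideanSpace ℝ (Fin 5)) 1) →
      ∀ (B : Type) [TopologicalSpace B] [T2Space B] [SecondCountableTopology B]
        [ChartedSpace (EuclideanHalfSpace 4) B] [IsManifold (𝓡∂ 4) ∞ B] [CompactSpace B]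
        (b : Literature.Topology.FourManifolds.BoundaryData (𝓡∂ 4) B (𝓡 3))
        (φ : b.carrier ≃ₘ⟮𝓡 3, 𝓡 3⟯ (Metric.sphere (0 : EuclideanSpace ℝ (Fin 4)) 1)),
        Literature.Topology.FourManifolds.IsBoundaryGluing b
            (Literature.Topology.FourManifolds.closedBallBoundaryData 3) φ (𝓡 4) M →
        ContractibleSpace B := by
  sorry

/-- **Stub 3 (THE BET, hardest) — a Stein-hosted fake ball is a 2-handlebody.**
For every compact Stein domain `X` (`IsSteinDomain X`), every compact CONTRACTIBLE smooth 4-manifold with boundary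
`B` with `∂B ≅ S³` (datum `b`, diffeomorphism `φ`) and every smooth embedding `e : B ↪ X` with image in `Int X`,
`B` carries a Morse function adapted to `∂B` all of whose critical points have index `≤ 2`
(`IsHandlebodyOfIndexLE 3 2 B`: `B = D⁴ ∪ 1-handles ∪ 2-handles`).
Why plausibly true: pull back a strictly `J`-convex Morse function `φ` of `X` along `e`; its INTERIOR critical
points in `B` have index `≤ 2` (tree, PROVED: `SteinStructure.morseIndex_le_two`); in the relative Morse theory of
`(B, ∂B)` boundary critical points of `φ|∂B` with `∇φ` pointing out of `B` change nothing and those with `∇φ`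
pointing into `B` attach a handle of the boundary index (KM Def. 2.4.1; BNR Lemmas 19–20, Thm. 27), so the only
possible 3-handles are inward local maxima of `φ|∂B`; the global maximum is outward, and the bet is that the
inward ones ("pockets", present e.g. for a mushroom-shaped ball in `ℂ²`) can always be eliminated — by
re-choosing the `J`-convex function near `e(B)` (drainage, idea `inward-maxima-are-three-handles`; the mushroom
drains under `|z - z₀|²` recentred at the stem), by a bilevel sweep-out, or by an isotopy of `B`. It is strictly
weaker than Lambert-Cole's Conj. 1.10 (a standard ball is a 0-handlebody) and SPC4-shielded (a counterexample
is a fake 4-ball, hence an exotic `S⁴`). Why it might fail: with isotopies allowed, "no pockets" is EQUIVALENT to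
"`B` is a 2-handlebody" (thin neighbourhoods of 2-complexes have inward boundary indices `≤ 2` for ANY generic
function), so the Stein structure acts only through interior indices and the fixed-`B` drainage; and for
NON-Stein 2-handlebody hosts the statement is ≡ SPC4 (every fake ball embeds in the 0-framed Hopf-link
handlebody `(#k S²×S²)°` by Wall stabilisation + Palais), so the Legendrian `tb - 1` framing condition must be
where it bites. Size: open problem (new statement; no counterexample can exist without an exotic `S⁴`).
[cite: Gompf1998, Thm. 1.3] [cite: Lambertcole2021, Conj. 1.10] [cite: KronheimerMrowka2007, Def. 2.4.1] -/
theorem stub_steinFakeBallTwoHandlebody :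
    ∀ (X : Type) [TopologicalSpace X] [T2Space X] [SecondCountableTopology X]
      [ChartedSpace (EuclideanHalfSpace 4) X] [IsManifold (𝓡∂ 4) ∞ X] [CompactSpace X],
      Literature.Geometry.Symplectic.IsSteinDomain X →
      ∀ (B : Type) [TopologicalSpace B] [T2Space B] [SecondCountableTopology B]
        [ChartedSpace (EuclideanHalfSpace 4) B] [IsManifold (𝓡∂ 4) ∞ B] [CompactSpace B]
        [ContractibleSpace B]
        (b : Literature.Topology.FourManifolds.BoundaryData (𝓡∂ 4) B (𝓡 3))
        (φ : b.carrier ≃ₘ⟮𝓡 3, 𝓡 3⟯ (Metric.sphere (0 : EuclideanSpace ℝ (Fin 4)) 1))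
        (e : B → X), Manifold.IsSmoothEmbedding (𝓡∂ 4) (𝓡∂ 4) ∞ e →
        Set.range e ⊆ (𝓡∂ 4).interior X →
        Literature.Topology.FourManifolds.IsHandlebodyOfIndexLE 3 2 B := by
  sorry

/-- **Stub 4 — capping off a 2-handlebody gives a Morse function without index-1 critical points
("turn the handle decomposition upside down"; a THEOREM).** If the compact boundaryless smooth 4-manifold `M` is a
boundary gluing `B ∪_φ 𝔻⁴` (`∂B ≅ S³`) of a handlebody `B` of index `≤ 2`, then `M` admits a Morse function `g`
with `criticalSetOfIndex (𝓡 4) g 1 = ∅`. Intended witness: `f` an adapted Morse function on `B` with indices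
`≤ 2` (`f ≡ 1 = max f` exactly on `∂B`, regular there), reparametrised by uniqueness of collars so that `f = 1 - s`
in the tubular coordinate `s` of the seam `∂B ⊂ M`; `g := -f` on `B` (indices `4 - k ≥ 2`) and
`g := G(‖x‖²)` on the disc with `G` increasing, `G(q) = -2 + q` near `0` (one minimum, index `0`) and
`G(q) = -2 + √q` near `1` (so `g = -1 + σ` is affine in the signed seam coordinate on both sides): smooth, Morse,
indices in `{0, 2, 3, 4}`. Milnor, *Lectures on the h-cobordism theorem* §3 (dual decomposition,
Thm. 3.12–3.13 / 4.? "`-f`"); Kosinski VII §1–2, VI.7; Gompf–Stipsicz §4.2 (upside-down handlebodies).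
Why plausibly true: it is a theorem. Size: L (formal: collar uniqueness across an `IsBoundaryGluing` seam, index
of `-f`, the radial interpolation). [cite: MilnorHCobordism1965, §3] [cite: Kosinski1993, VII.1.2]
[cite: GompfStipsicz1999, §4.2] -/
theorem stub_capOffNoIndexOne :
    ∀ (M : Type) [TopologicalSpace M] [T2Space M] [SecondCountableTopology M]
      [ChartedSpace (EuclideanSpace ℝ (Fin 4)) M] [IsManifold (𝓡 4) ∞ M] [CompactSpace M]
      (B : Type) [TopologicalSpace B] [T2Space B] [SecondCountableTopology B]
        [ChartedSpace (EuclideanHalfSpace 4) B] [IsManifold (𝓡∂ 4) ∞ B] [CompactSpace B]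
        (b : Literature.Topology.FourManifolds.BoundaryData (𝓡∂ 4) B (𝓡 3))
        (φ : b.carrier ≃ₘ⟮𝓡 3, 𝓡 3⟯ (Metric.sphere (0 : EuclideanSpace ℝ (Fin 4)) 1)),
        Literature.Topology.FourManifolds.IsBoundaryGluing b
            (Literature.Topology.FourManifolds.closedBallBoundaryData 3) φ (𝓡 4) M →
        Literature.Topology.FourManifolds.IsHandlebodyOfIndexLE 3 2 B →
        ∃ g : M → ℝ, Literature.Topology.FourManifolds.IsMorse (𝓡 4) g ∧
          Literature.Topology.FourManifolds.criticalSetOfIndex (𝓡 4) g 1 = ∅ := by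
  sorry

/-- **Stub 5 — geometrically simply connected homotopy 4-spheres are standard (weak Generalised Property R),
BY NAME the open route item `NoOneHandles.NoohGscStandard` (stmt-SmoothPoincare4-0377, rank 2, shared with route
`route-SmoothPoincare4-NoOneHandles`):** every oriented homotopy 4-sphere carrying a Morse function without
index-1 critical points is diffeomorphic to `S⁴`. With no 1-handles, `χ = 2` and `H₂ = 0` force `n` 2-handles and
`n` 3-handles, the 2-handles along a framed `n`-component R-link (0-surgery `≅ #ⁿ S¹×S²`); base case `n ≤ 1`
is Gabai's Property R, `n = 2` with a generalised square knot component is Meier–Zupan; equivalent to SPC4 for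
homotopy spheres without 1-handles (Gompf–Scharlemann–Thompson). Why it might fail: the full weak GPRC is open and
GST exhibit R-links not known to be slide-equivalent to unlinks. Size: open problem (named, with an active
programme). [cite: GompfScharlemannThompson2010, Conj. 4 and §8] [cite: MeierZupan2022, Thm. 1.1]
[cite: Gabai1987, Property R] -/
theorem stub_gscStandard :
    Summit.SmoothPoincare4.SmoothPoincare4.Theses.NoOneHandles.NoohGscStandard := by
  sorry

/-! ## Name-keyed aliases of the five stub statements (hypotheses of the composition) -/
namespace Registered

/-- Alias: the signature of `stub_ballInHost`. -/
abbrev stub_ballInHost : Prop :=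
    ∀ (M : Type) [TopologicalSpace M] [T2Space M] [SecondCountableTopology M]
      [ChartedSpace (EuclideanSpace ℝ (Fin 4)) M] [IsManifold (𝓡 4) ∞ M] [CompactSpace M] (p : M)
      (X : Type) [TopologicalSpace X] [T2Space X] [SecondCountableTopology X]
      [ChartedSpace (EuclideanHalfSpace 4) X] [IsManifold (𝓡∂ 4) ∞ X]
      (f : (⟨{p}ᶜ, isOpen_compl_singleton⟩ : TopologicalSpace.Opens M) → X),
      Manifold.IsSmoothEmbedding (𝓡 4) (𝓡∂ 4) ∞ f →
      ∃ (B : Type) (_ : TopologicalSpace B) (_ : T2Space B) (_ : SecondCountableTopology B)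
        (_ : ChartedSpace (EuclideanHalfSpace 4) B) (_ : IsManifold (𝓡∂ 4) ∞ B) (_ : CompactSpace B)
        (b : Literature.Topology.FourManifolds.BoundaryData (𝓡∂ 4) B (𝓡 3))
        (φ : b.carrier ≃ₘ⟮𝓡 3, 𝓡 3⟯ (Metric.sphere (0 : EuclideanSpace ℝ (Fin 4)) 1))
        (e : B → X),
        Manifold.IsSmoothEmbedding (𝓡∂ 4) (𝓡∂ 4) ∞ e ∧
          Set.range e ⊆ (𝓡∂ 4).interior X ∧
          Literature.Topology.FourManifolds.IsBoundaryGluing b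
            (Literature.Topology.FourManifolds.closedBallBoundaryData 3) φ (𝓡 4) M

/-- Alias: the signature of `stub_complementContractible`. -/
abbrev stub_complementContractible : Prop :=
    ∀ (M : Type) [TopologicalSpace M] [T2Space M] [SecondCountableTopology M]
      [ChartedSpace (EuclideanSpace ℝ (Fin 4)) M] [IsManifold (𝓡 4) ∞ M],
      ContinuousMap.HomotopyEquiv M (Metric.sphere (0 : EuclideanSpace ℝ (Fin 5)) 1) →
      ∀ (B : Type) [TopologicalSpace B] [T2Space B] [SecondCountableTopology B]
        [ChartedSpace (EuclideanHalfSpace 4) B] [IsManifold (𝓡∂ 4) ∞ B] [CompactSpace B]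
        (b : Literature.Topology.FourManifolds.BoundaryData (𝓡∂ 4) B (𝓡 3))
        (φ : b.carrier ≃ₘ⟮𝓡 3, 𝓡 3⟯ (Metric.sphere (0 : EuclideanSpace ℝ (Fin 4)) 1)),
        Literature.Topology.FourManifolds.IsBoundaryGluing b
            (Literature.Topology.FourManifolds.closedBallBoundaryData 3) φ (𝓡 4) M →
        ContractibleSpace B

/-- Alias: the signature of `stub_steinFakeBallTwoHandlebody`. -/
abbrev stub_steinFakeBallTwoHandlebody : Prop :=
    ∀ (X : Type) [TopologicalSpace X] [T2Space X] [SecondCountableTopology X]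
      [ChartedSpace (EuclideanHalfSpace 4) X] [IsManifold (𝓡∂ 4) ∞ X] [CompactSpace X],
      Literature.Geometry.Symplectic.IsSteinDomain X →
      ∀ (B : Type) [TopologicalSpace B] [T2Space B] [SecondCountableTopology B]
        [ChartedSpace (EuclideanHalfSpace 4) B] [IsManifold (𝓡∂ 4) ∞ B] [CompactSpace B]
        [ContractibleSpace B]
        (b : Literature.Topology.FourManifolds.BoundaryData (𝓡∂ 4) B (𝓡 3))
        (φ : b.carrier ≃ₘ⟮𝓡 3, 𝓡 3⟯ (Metric.sphere (0 : EuclideanSpace ℝ (Fin 4)) 1))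
        (e : B → X), Manifold.IsSmoothEmbedding (𝓡∂ 4) (𝓡∂ 4) ∞ e →
        Set.range e ⊆ (𝓡∂ 4).interior X →
        Literature.Topology.FourManifolds.IsHandlebodyOfIndexLE 3 2 B

/-- Alias: the signature of `stub_capOffNoIndexOne`. -/
abbrev stub_capOffNoIndexOne : Prop :=
    ∀ (M : Type) [TopologicalSpace M] [T2Space M] [SecondCountableTopology M]
      [ChartedSpace (EuclideanSpace ℝ (Fin 4)) M] [IsManifold (𝓡 4) ∞ M] [CompactSpace M]
      (B : Type) [TopologicalSpace B] [T2Space B] [SecondCountableTopology B]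
        [ChartedSpace (EuclideanHalfSpace 4) B] [IsManifold (𝓡∂ 4) ∞ B] [CompactSpace B]
        (b : Literature.Topology.FourManifolds.BoundaryData (𝓡∂ 4) B (𝓡 3))
        (φ : b.carrier ≃ₘ⟮𝓡 3, 𝓡 3⟯ (Metric.sphere (0 : EuclideanSpace ℝ (Fin 4)) 1)),
        Literature.Topology.FourManifolds.IsBoundaryGluing b
            (Literature.Topology.FourManifolds.closedBallBoundaryData 3) φ (𝓡 4) M →
        Literature.Topology.FourManifolds.IsHandlebodyOfIndexLE 3 2 B →
        ∃ g : M → ℝ, Literature.Topology.FourManifolds.IsMorse (𝓡 4) g ∧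
          Literature.Topology.FourManifolds.criticalSetOfIndex (𝓡 4) g 1 = ∅

/-- Alias: the signature of `stub_gscStandard`. -/
abbrev stub_gscStandard : Prop :=
    Summit.SmoothPoincare4.SmoothPoincare4.Theses.NoOneHandles.NoohGscStandard

end Registered

/-! ## The composition (kernel-checked, sorry-free) -/

/-- **Skeleton theorem — the crux BY NAME from the five stubs.** Given the binders of `SteinSchoenflies`
(`M`, `he : M ≃ₕ S⁴`, `p`, a compact Stein domain `X`, a smooth embedding `f : M ∖ {p} ↪ X`): `M` is compact
(`compactSpace_of_homotopyEquiv_sphere_four_holds`, PROVED) and orientable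
(`isOrientable_of_homotopyEquiv_sphere_four_holds`, PROVED); stub 1 presents `M = B ∪_φ 𝔻⁴` with `B ↪ Int X`;
stub 2 makes `B` contractible; the bet makes `B` a 2-handlebody; stub 4 caps it off to a Morse function on `M`
without index-1 critical points; weak GPR (`NoohGscStandard`, applied to the packaged `HomotopySphere 4`)
gives `M ≅ S⁴`. [cite: GompfScharlemannThompson2010, Conj. 4] [cite: Gompf1998, Thm. 1.3]
[cite: Lambertcole2021, Conj. 1.10] -/
theorem SteinSchoenflies_of :
    Registered.stub_ballInHost → Registered.stub_complementContractible →
      Registered.stub_steinFakeBallTwoHandlebody → Registered.stub_capOffNoIndexOne →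
      Registered.stub_gscStandard → SteinSchoenflies := by
  intro hBall hContr hBet hCap hGsc M _ _ _ _ _ he p X _ _ _ _ _ _ hX f hf
  -- a homotopy 4-sphere is compact and orientable
  haveI : CompactSpace M := compactSpace_of_homotopyEquiv_sphere_four_holds M he
  obtain ⟨o⟩ := isOrientable_of_homotopyEquiv_sphere_four_holds M he
  -- split off a chart ball round `p`: `M = B ∪_φ 𝔻⁴`, with the compact piece `B` embedded in `Int X`
  obtain ⟨B, _, _, _, _, _, _, b, φ, e, heemb, hint, hglue⟩ := hBall M p X f hf
  -- the compact piece is a homotopy ball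
  haveI : ContractibleSpace B := hContr M he B b φ hglue
  -- THE BET: inside a Stein domain it is a 2-handlebody
  have hB2 : IsHandlebodyOfIndexLE 3 2 B := hBet X hX B b φ e heemb hint
  -- cap off: `M` has a Morse function without index-1 critical points
  obtain ⟨g, hg, h1⟩ := hCap M B b φ hglue hB2
  -- weak Generalised Property R for the packaged homotopy sphere
  exact hGsc ⟨M, o, ⟨he⟩⟩ g hg h1

/-- Wiring check: the five registered stubs feed `SteinSchoenflies_of` exactly as stated (aliases = signatures), so
the skeleton is `SteinSchoenflies` closed modulo the stubs; sorries enter only through them. -/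
example : SteinSchoenflies :=
  SteinSchoenflies_of stub_ballInHost stub_complementContractible stub_steinFakeBallTwoHandlebody
    stub_capOffNoIndexOne stub_gscStandard

end Summit.SmoothPoincare4.SmoothPoincare4.Cruxes.SteinSchoenflies.SteinGsc

end
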